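import Summits.PneNP.PneNP.Theorems.QuotientSABlockModel

/-!
# ROUND-22 COR-B, target B3 (`BlockExpandExist`), part II: bad outcomes and the union bound (cell `pnp-ideate`)

FRONTIER range-avoidance ladder, rung F-N3 context (restricted-model combinatorics; nothing here bears on `P` vs `NP`).

The counting layer over p3's random block model `QuotientSABlockModel.Outcome s nb n' = Fin nb → (Slot s ↪ Fin n')` — the
arity-`K` (`K = kBlk s = (s+1)s`) form of prover-1's `IP3ExpandingCount`:

* `nbω ω J` — the A-variables met by the blocks of `J` (= `nbhd (blk (sysOf d ω) b) J` for every junk value `d` and target `b`,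
  `nbhd_blk_eq`); an outcome is `bad` at radius `r` if some `≤ r` blocks meet fewer than `(K − 5/4)·#J` A-variables;
  `good_of_not_bad` feeds `QuotientSABlockModel.blockSys_of_good`;
* the threshold `vK K f = K f − ⌈5f/4⌉` (`le_vK_of_lt`, `vK_add`, `vK_le`);
* cylinders `cyl J A` with the product count `card_cyl`, the cover `cover` and the containment `badSet_subset`, and
  **the union bound** `card_badSet_le`:
  `#bad ≤ Σ_{i<r} C(nb, i+1)·C(n', vK K (i+1))·((vK K (i+1))^K)^{i+1}·Q^{nb−(i+1)}`, `Q = #(Slot s ↪ Fin n')`.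
-/

set_option linter.dupNamespace false

open Finset Literature.Computability.Complexity
open Summit.PneNP.PneNP.Theorems.PstarSAClosure (nbhd)
open Summit.PneNP.PneNP.Theorems.QuotientSABlocks
open Summit.PneNP.PneNP.Theorems.QuotientSABlockModel

namespace Summit.PneNP.PneNP.Theorems.QuotientSABlockCount

variable {s nb n' : ℕ}

/-! ## Bad outcomes -/

/-- The A-variables met by the blocks of `J`. -/
def nbω (ω : Outcome s nb n') (J : Finset (Fin nb)) : Finset (Fin n') := J.biUnion fun β => univ.image (ω β)

/-- `N(J)` of the block map of an outcome is `nbω ω J`, whatever the junk value and the target. -/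
theorem nbhd_blk_eq (d : Fin n') (ω : Outcome s nb n') (b : Fin (βOut s nb) → Bool) (J : Finset (Fin nb)) :
    nbhd (blk (sysOf d ω) b) J = nbω ω J := by
  ext v
  rw [mem_nbhd_blk]
  simp only [nbω, Finset.mem_biUnion, Finset.mem_image, Finset.mem_univ, true_and]

/-- An outcome is BAD at radius `r` if some `≤ r` blocks meet fewer than `(K − 5/4)·#J` A-variables. -/
def bad (r : ℕ) (ω : Outcome s nb n') : Prop :=
  ∃ J : Finset (Fin nb), J.card ≤ r ∧ ¬(4 * kBlk s * J.card ≤ 4 * (nbω ω J).card + 5 * J.card)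

/-- A good outcome is vertex expanding for every junk value and target (the hypothesis of `blockSys_of_good`). -/
theorem good_of_not_bad {r : ℕ} {ω : Outcome s nb n'} (h : ¬bad r ω) (d : Fin n') :
    ∀ (b : Fin (βOut s nb) → Bool) (J : Finset (Fin nb)), J.card ≤ r →
      4 * kBlk s * J.card ≤ 4 * (nbhd (blk (sysOf d ω) b) J).card + 5 * J.card := by
  intro b J hJ
  rw [nbhd_blk_eq]
  by_contra hlt
  exact h ⟨J, hJ, hlt⟩

/-! ## The threshold -/

/-- The threshold `vK K f = K f − ⌈5f/4⌉`. -/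
def vK (K f : ℕ) : ℕ := K * f - (5 * f + 3) / 4

/-- `vK K f + ⌈5f/4⌉ = K f` for `K ≥ 2`. -/
theorem vK_add {K : ℕ} (hK : 2 ≤ K) (f : ℕ) : vK K f + (5 * f + 3) / 4 = K * f := by
  unfold vK
  have : 2 * f ≤ K * f := Nat.mul_le_mul_right f hK
  omega

/-- A bad family of size `f` meets at most `vK K f` A-variables. -/
theorem le_vK_of_lt {K f V : ℕ} (h : ¬(4 * K * f ≤ 4 * V + 5 * f)) : V ≤ vK K f := by
  unfold vK
  have e : 4 * K * f = 4 * (K * f) := by ring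
  rw [e] at h
  omega

/-- `vK K f ≤ K f`. -/
theorem vK_le (K f : ℕ) : vK K f ≤ K * f := Nat.sub_le _ _

/-! ## Cylinders and their size -/

/-- Outcomes whose blocks in `J` have all slots inside `A`. -/
noncomputable def cyl (J : Finset (Fin nb)) (A : Finset (Fin n')) : Finset (Outcome s nb n') :=
  Fintype.piFinset fun β => if β ∈ J then embIn A else univ

/-- Membership in a cylinder. -/
theorem mem_cyl {J : Finset (Fin nb)} {A : Finset (Fin n')} {ω : Outcome s nb n'} :
    ω ∈ cyl J A ↔ ∀ β ∈ J, ω β ∈ embIn A := by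
  simp only [cyl, Fintype.mem_piFinset]
  constructor
  · intro h β hβ
    have := h β
    rwa [if_pos hβ] at this
  · intro h β
    by_cases hβ : β ∈ J
    · rw [if_pos hβ]; exact h β hβ
    · rw [if_neg hβ]; exact Finset.mem_univ _

/-- **Product count**: `#cyl J A = #(embIn A)^{#J} · Q^{nb − #J}`, `Q = #(Slot s ↪ Fin n')`. -/
theorem card_cyl (J : Finset (Fin nb)) (A : Finset (Fin n')) :
    (cyl (s := s) J A).card = (embIn (s := s) A).card ^ J.card * (Fintype.card (Slot s ↪ Fin n')) ^ (nb - J.card) := by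
  classical
  unfold cyl
  rw [Fintype.card_piFinset]
  have h : ∀ β : Fin nb, (if β ∈ J then embIn A else (univ : Finset (Slot s ↪ Fin n'))).card =
      if β ∈ J then (embIn (s := s) A).card else Fintype.card (Slot s ↪ Fin n') := by
    intro β; split_ifs <;> simp
  simp_rw [h]
  rw [Finset.prod_ite, Finset.prod_const, Finset.prod_const]
  congr 2
  · rw [Finset.filter_mem_eq_inter, Finset.univ_inter]
  · rw [Finset.filter_not, Finset.filter_mem_eq_inter, Finset.univ_inter, Finset.card_univ_sdiff, Fintype.card_fin]

/-! ## The containment of the bad set -/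

/-- The bad outcomes. -/
noncomputable def badSet (s nb n' r : ℕ) : Finset (Outcome s nb n') := by
  classical exact univ.filter fun ω => bad r ω

/-- The covering family: over sizes `f = i + 1`, `i < r`, sets `J` of that size and A-variable sets of size `vK K f`. -/
noncomputable def cover (s nb n' r : ℕ) : Finset (Outcome s nb n') :=
  (Finset.range r).biUnion fun i => ((univ : Finset (Fin nb)).powersetCard (i + 1)).biUnion fun J =>
    ((univ : Finset (Fin n')).powersetCard (vK (kBlk s) (i + 1))).biUnion fun A => cyl J A

/-- **Containment**: if `K·r ≤ n'`, every bad outcome lies in the cover. -/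
theorem badSet_subset (r : ℕ) (hr : kBlk s * r ≤ n') : badSet s nb n' r ⊆ cover s nb n' r := by
  classical
  intro ω hω
  simp only [badSet, Finset.mem_filter, Finset.mem_univ, true_and] at hω
  obtain ⟨J, hJr, hJ⟩ := hω
  have hf : 1 ≤ J.card := by
    rw [Nat.one_le_iff_ne_zero]
    intro h0
    rw [Finset.card_eq_zero] at h0
    subst h0
    exact hJ (by simp)
  have hV : (nbω ω J).card ≤ vK (kBlk s) J.card := le_vK_of_lt hJ
  have hvN : vK (kBlk s) J.card ≤ n' :=
    (vK_le _ _).trans ((Nat.mul_le_mul_left _ hJr).trans hr)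
  have hn' : 0 < n' := by
    have : 1 ≤ kBlk s * J.card := by
      have hK : 4 * kBlk s * J.card > 0 := by omega
      nlinarith
    nlinarith [Nat.mul_le_mul_left (kBlk s) hJr]
  have hV' : (nbhd (blk (sysOf ⟨0, hn'⟩ ω) (fun _ => true)) J).card ≤ vK (kBlk s) J.card := by rwa [nbhd_blk_eq]
  obtain ⟨A, hA, hmem⟩ := exists_set_of_small_nbhd ⟨0, hn'⟩ ω (fun _ => true) J (vK (kBlk s) J.card) hvN hV'
  simp only [cover, Finset.mem_biUnion, Finset.mem_range, Finset.mem_powersetCard]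
  refine ⟨J.card - 1, by omega, J, ⟨Finset.subset_univ _, by omega⟩, A, ⟨Finset.subset_univ _, ?_⟩, mem_cyl.2 hmem⟩
  rw [hA]; congr 1; omega

/-! ## The union bound -/

/-- Size of a cylinder over a set of size `v`, in `ℝ`: `≤ (v^K)^{#J} · Q^{nb − #J}`. -/
theorem card_cyl_le (J : Finset (Fin nb)) {A : Finset (Fin n')} {v : ℕ} (hA : A.card = v) :
    ((cyl (s := s) J A).card : ℝ) ≤
      ((v : ℝ) ^ kBlk s) ^ J.card * (Fintype.card (Slot s ↪ Fin n') : ℝ) ^ (nb - J.card) := by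
  rw [card_cyl]
  push_cast
  refine mul_le_mul_of_nonneg_right (pow_le_pow_left₀ (by positivity) ?_ _) (by positivity)
  have := card_embIn_le (s := s) A
  rw [hA] at this
  exact_mod_cast this

/-- **The union bound.**  If `K·r ≤ n'` then
`#bad ≤ Σ_{i<r} C(nb, i+1)·C(n', vK K (i+1))·((vK K (i+1))^K)^{i+1}·Q^{nb−(i+1)}`. -/
theorem card_badSet_le (r : ℕ) (hr : kBlk s * r ≤ n') :
    ((badSet s nb n' r).card : ℝ) ≤ ∑ i ∈ Finset.range r,
      (nb.choose (i + 1) : ℝ) * (n'.choose (vK (kBlk s) (i + 1)) : ℝ) *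
        (((vK (kBlk s) (i + 1) : ℕ) : ℝ) ^ kBlk s) ^ (i + 1) *
        (Fintype.card (Slot s ↪ Fin n') : ℝ) ^ (nb - (i + 1)) := by
  classical
  have h0 : ((badSet s nb n' r).card : ℝ) ≤ ((cover s nb n' r).card : ℝ) := by
    exact_mod_cast Finset.card_le_card (badSet_subset r hr)
  refine h0.trans ?_
  unfold cover
  refine (Nat.cast_le.2 Finset.card_biUnion_le).trans ?_
  push_cast
  refine Finset.sum_le_sum fun i _ => ?_
  refine (Nat.cast_le (α := ℝ).2 Finset.card_biUnion_le).trans ?_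
  push_cast
  have hJ : ∀ J ∈ (univ : Finset (Fin nb)).powersetCard (i + 1),
      ((((univ : Finset (Fin n')).powersetCard (vK (kBlk s) (i + 1))).biUnion fun A => cyl (s := s) J A).card : ℝ) ≤
        (n'.choose (vK (kBlk s) (i + 1)) : ℝ) * (((vK (kBlk s) (i + 1) : ℕ) : ℝ) ^ kBlk s) ^ (i + 1) *
          (Fintype.card (Slot s ↪ Fin n') : ℝ) ^ (nb - (i + 1)) := by
    intro J hJ
    rw [Finset.mem_powersetCard] at hJ
    refine (Nat.cast_le (α := ℝ).2 Finset.card_biUnion_le).trans ?_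
    push_cast
    have hterm : ∀ A ∈ (univ : Finset (Fin n')).powersetCard (vK (kBlk s) (i + 1)),
        ((cyl (s := s) J A).card : ℝ) ≤
          (((vK (kBlk s) (i + 1) : ℕ) : ℝ) ^ kBlk s) ^ (i + 1) * (Fintype.card (Slot s ↪ Fin n') : ℝ) ^ (nb - (i + 1)) := by
      intro A hA
      rw [Finset.mem_powersetCard] at hA
      have := card_cyl_le (s := s) (nb := nb) J hA.2
      rwa [hJ.2] at this
    refine (Finset.sum_le_sum hterm).trans ?_
    rw [Finset.sum_const, nsmul_eq_mul, Finset.card_powersetCard, Finset.card_univ, Fintype.card_fin]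
    exact le_of_eq (by ring)
  refine (Finset.sum_le_sum hJ).trans ?_
  have hc : ((univ : Finset (Fin nb)).powersetCard (i + 1)).card = nb.choose (i + 1) := by
    rw [Finset.card_powersetCard, Finset.card_univ, Fintype.card_fin]
  rw [Finset.sum_const, nsmul_eq_mul, hc]
  exact le_of_eq (by ring)

end Summit.PneNP.PneNP.Theorems.QuotientSABlockCount
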